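import Summits.QuantumFields.YangMills.Theorems.UnitScaleTiltHistoryTailLaneTailV4ChiDisplays
import Summits.QuantumFields.YangMills.Theorems.UnitScaleTiltMinimiserStabilityRegPrAttainmentOfExistence
import Summits.QuantumFields.YangMills.Theorems.UnitScaleTiltMinimiserStabilityRegPrStubHalvingStep
import Summits.QuantumFields.YangMills.Theorems.AlphaInputsT3ACv4SeamWindowDL
import HarnessLib

/-!
# UV3 ∕ R3 crux `HistoryTailL` (stmt-QuantumFields-19936) — THE K2 DAG OF RECORD WITH ITS (T8) ROW READ OFF 19200's ONE OPEN REGISTERED ROW: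
# `HistoryTailL` ⇐ ⟨19200 v10 `stub_existenceMinimalOrbit` (EX), VERBATIM⟩ ∧ ⟨NODE O's Sel∕Xs v4 χ-data rows (O‴χₛ)⟩ — the halving leaf H is LANDED and is discharged here BY NAME

Width seat `ym-ust-19936-w3` (gen 20); ★★OWNER WORD 85 (2)∕(3) (RECORD-UNBUNDLING census #48: the χ-record `AlphaInputsT3ACv4RecChi` is, by landed glue, exactly TWO open
content rows (T8) ∧ (O‴χₛ); question (3): «is `MinimiserStabilityRegPr → (T8)` landed or a short knit?»).  ANSWER BY KERNEL, in this file: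
* NOT from the crux TEXT `MinimiserStabilityRegPr` (a STABILITY estimate on the minimal action VALUES `|β_{K+1}·m_{K+1}(V) − β_K·m_K(V) − κ_K| ≤ r_K` — a different
  statement from (T8) = attainment over (6) + «minimisers lie in (8)»; neither implies the other as typed), BUT from 19200's REGISTERED SKELETON v10
  (`Cruxes/MinimiserStabilityRegPr/Lines/birth_v10.lean`) = {H `stub_halvingStep`, EX `stub_existenceMinimalOrbit`}: ★ym-ust-20520-w4 g0's
  ✓ `AttainmentOfExistence.thm1In8GlobalMin_of_halvingStep_of_existence : ⟨H text⟩ → ⟨EX text⟩ → ⟨(T8) text⟩`, and H is LANDED (✓ p705908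
  `MinimiserStabilityRegPrStubHalvingStep.stub_halvingStep`).  Hence:
* §1 ★ `thm1In8_allL_of_existenceMinimalOrbit : ⟨EX text VERBATIM⟩ → ∀ L, Odd L → 1 < L → ∃ a₀ a₁ B₃ > 0, Thm1GlobalMinAt L a₀ a₁ B₃ ∧ MinimisersIn8At L a₀ a₁ B₃` — the (T8) row of
  the K2 DAG is 19200's ONE open registered row EX (one supplier theorem closes EX on 19200 AND the (T8) row here).
* §2 ★★★ `historyTailL_of_existenceMinimalOrbit_selXsV4DataRows_allL (hEX) (hrows) : …Theses.UnitScaleTilt.HistoryTailL` — the L-R4 door of record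
  ✓ `historyTailL_of_thm1In8_selXsV4DataRows_allL` with its `hT8` binder DISCHARGED from `hEX`: the two-row display {EX, (O‴χₛ)+record rows} concludes the crux BY NAME.
* §3 ★★ `laneRecordsV4Chi_of_existenceMinimalOrbit_nestedDataRows_dL (hEX) (hrows)` (conclusion = 19936's displayed row text `∀ L, Odd L → 1 < L → AlphaInputsT3ACv4RecChi L`) and
  `historyTailL_of_existenceMinimalOrbit_nestedDataRows_dL` — the same over ★w6-19936 g2's
  nested-display closer ✓ `laneRecordsV4Chi_of_thm1In8_nestedDataRows_dL` (seam (71)_sym discharged from the `γ₀`-row; nested display true-but-vacuous at the vortex datum —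
  BILL §8, recorded for completeness; Sel∕Xs is the display of record).
HONEST: three compositions of landed theorems (no analysis); EX and (O‴χₛ) are DISPLAYED hypotheses, NOT proved; nothing of [Balaban1985Variational] Thm 1 ∕ Prop. 7 or of
[Balaban1985UV3] Sect. B–C is proved here; 19936 `HistoryTailL` is NOT proved — it is REDUCED to {EX, (O‴χₛ)}; rung R3 = SU(2) YM₃ on T³ — not d = 4, not infinite volume,
not a mass gap, not Clay.
-/

set_option autoImplicit false

noncomputable section

namespace Summit.QuantumFields.YangMills.Theorems.HistoryTailOfExistenceMinimalOrbit

open MeasureTheory Set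
open scoped Matrix.Norms.L2Operator
open Literature.MathematicalPhysics.QuantumFieldTheory.Balaban1983to89
open Literature.MathematicalPhysics.QuantumFieldTheory.Balaban1983to89.T3ContinuumYM3Torus
open Literature.MathematicalPhysics.QuantumFieldTheory.Balaban1983to89.T3UnitLawDensityEML (ℰp)
open Literature.MathematicalPhysics.QuantumFieldTheory.Balaban1983to89.T3PrintedRegularMinimiser
open Literature.MathematicalPhysics.QuantumFieldTheory.Balaban1983to89.T3PrintedMinimiserExistence
open Literature.MathematicalPhysics.QuantumFieldTheory.Balaban1983to89.T3ConstrainedMinimiser (fibre)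
open Literature.MathematicalPhysics.QuantumFieldTheory.Balaban1983to89.T3LowerAlongMinimisersSplit (MinimisersIn8At)
open Literature.MathematicalPhysics.QuantumFieldTheory.Balaban1983to89.T3Thm1Carrier (famX Idx)
open Literature.MathematicalPhysics.QuantumFieldTheory.Balaban1983to89.ExpMeanLog (deltaSU)
open Literature.MathematicalPhysics.QuantumFieldTheory.Balaban1985CMP102
open Literature.MathematicalPhysics.QuantumFieldTheory.Balaban1985CMP102.Setting
open Summit.QuantumFields.Balaban3D.Carriers
open Summit.QuantumFields.Balaban3D.Proofs.Primitives
open Summit.QuantumFields.Balaban3D.Proofs.Thresholds (Q0)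
open B7Prop2Explicit (C0)
open Summit.QuantumFields.YangMills.Theorems.AttainmentOfExistence (thm1In8GlobalMin_of_halvingStep_of_existence)
open Summit.QuantumFields.YangMills.Theorems.MinimiserStabilityRegPrStubHalvingStep (stub_halvingStep)
open Summit.QuantumFields.YangMills.Theorems.HistoryTailLaneTailV4Chi (historyTailL_of_thm1In8_selXsV4DataRows_allL historyTailL_of_laneRecordsV4Chi)
open Summit.QuantumFields.YangMills.Theorems.HistoryTailSelSupplier (laneRecordsV4Chi_of_thm1In8_nestedDataRows_dL)

/-! ## §1 (T8) from 19200's one open registered row EX — the halving leaf H is landed -/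

/-- ★ **(T8) — [Balaban1985Variational] THM 1 (GLOBAL READING) WITH ITS (8)-CLAUSE AT EVERY ODD `L > 1` — FROM 19200's REGISTERED ROW EX ALONE**: the hypothesis is the text of
`Cruxes/MinimiserStabilityRegPr/Lines/birth_v10.lean`'s `stub_existenceMinimalOrbit` VERBATIM (Prop. 7's existence clause from a background (14), reading R1, every `B₃ > 4`); the
halving leaf `stub_halvingStep` (H, the other v10 row) is the LANDED theorem ✓ `MinimiserStabilityRegPrStubHalvingStep.stub_halvingStep`; the composition is ★w4-20520 g0's
`AttainmentOfExistence.thm1In8GlobalMin_of_halvingStep_of_existence` (halving ⟹ Prop. 8 ⟹ attainment over (6) with EX; Prop. 8 ⟹ (8) for every minimiser; common window).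
[cite: Balaban1985Variational, Thm 1 (8) p.279, Prop. 7 p.299, Prop. 8 p.304] -/
theorem thm1In8_allL_of_existenceMinimalOrbit
    (hEX : ∀ (L : ℕ), 1 < L → ∀ (B₃ : ℝ), 4 < B₃ → ∃ a₁' O₁ : ℝ, 0 < a₁' ∧ 1 ≤ O₁ ∧
      ∀ (F : T3Family), F.L = L → ∀ (n K : ℕ) (hnK : n < K) (ε₁ : ℝ), 0 < ε₁ →
        ∀ V : GaugeField (F.P n) 0 (Matrix.specialUnitaryGroup (Fin 2) ℂ), PlaqSmall ε₁ V →
          ∀ U₀ : GaugeField (F.P K) 0 (Matrix.specialUnitaryGroup (Fin 2) ℂ), RegPr F n K ((L : ℝ) ^ 3 * B₃ * ε₁) U₀ → U₀ ∈ fibre F ℰp n K hnK.le V →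
            ε₁ ≤ a₁' → ∃ U ∈ regFibrePr F n K hnK.le (O₁ * (L : ℝ) ^ 3 * B₃ * ε₁) V,
              IsMinOn (fun W : GaugeField (F.P K) 0 (Matrix.specialUnitaryGroup (Fin 2) ℂ) => wilsonAction4 W)
                (regFibrePr F n K hnK.le (O₁ * (L : ℝ) ^ 3 * B₃ * ε₁) V) U) :
    ∀ L : ℕ, Odd L → 1 < L → ∃ a₀ a₁ B₃ : ℝ, 0 < a₀ ∧ 0 < a₁ ∧ 0 < B₃ ∧
      Thm1GlobalMinAt L a₀ a₁ B₃ ∧ MinimisersIn8At L a₀ a₁ B₃ :=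
  thm1In8GlobalMin_of_halvingStep_of_existence stub_halvingStep hEX

/-! ## §2 The K2 DAG of record with its first row = EX: `HistoryTailL` ⇐ EX ∧ ⟨(O‴χₛ) Sel∕Xs v4 χ-data rows on the supplier's box⟩ -/

/-- ★★★ **`HistoryTailL` FROM 19200's ROW EX AND NODE O's Sel∕Xs v4 SUPPLIER ROWS, BY NAME** — the L-R4 door of record ✓ `HistoryTailLaneTailV4Chi.historyTailL_of_thm1In8_selXsV4DataRows_allL`
with its `hT8` binder discharged by §1; `hrows` is that door's second binder VERBATIM (a floor `B₀` and a box `(0, A₀] × (0, A₁]` per odd `L`, on which the record rows — exact profile,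
`B₃ = B`, the three `C68`-sizes —, the seam row (71)_sym and ONE measurable minimiser selection in `𝒞_Xs` with its Sect. B–C χ-data are served).  CONDITIONAL — EX and (O‴χₛ) are
displayed, not proved. [cite: Balaban1985Variational, Thm 1 (8) p.279, Prop. 7 p.299, Prop. 8 p.304; Balaban1985UV3, (5) p.256, (47) p.267, (67)–(71) p.273 and Thm 2 p.272] -/
theorem historyTailL_of_existenceMinimalOrbit_selXsV4DataRows_allL
    (hEX : ∀ (L : ℕ), 1 < L → ∀ (B₃ : ℝ), 4 < B₃ → ∃ a₁' O₁ : ℝ, 0 < a₁' ∧ 1 ≤ O₁ ∧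
      ∀ (F : T3Family), F.L = L → ∀ (n K : ℕ) (hnK : n < K) (ε₁ : ℝ), 0 < ε₁ →
        ∀ V : GaugeField (F.P n) 0 (Matrix.specialUnitaryGroup (Fin 2) ℂ), PlaqSmall ε₁ V →
          ∀ U₀ : GaugeField (F.P K) 0 (Matrix.specialUnitaryGroup (Fin 2) ℂ), RegPr F n K ((L : ℝ) ^ 3 * B₃ * ε₁) U₀ → U₀ ∈ fibre F ℰp n K hnK.le V →
            ε₁ ≤ a₁' → ∃ U ∈ regFibrePr F n K hnK.le (O₁ * (L : ℝ) ^ 3 * B₃ * ε₁) V,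
              IsMinOn (fun W : GaugeField (F.P K) 0 (Matrix.specialUnitaryGroup (Fin 2) ℂ) => wilsonAction4 W)
                (regFibrePr F n K hnK.le (O₁ * (L : ℝ) ^ 3 * B₃ * ε₁) V) U)
    (hrows : ∀ L : ℕ, Odd L → 1 < L → ∃ (B₀ A₀ A₁ : ℝ), 0 < A₀ ∧ 0 < A₁ ∧
      ∀ (B a₀ a₁ : ℝ), B₀ ≤ B → 1 ≤ 2 * B → 0 < a₀ → a₀ ≤ A₀ → 0 < a₁ → a₁ ≤ A₁ → B * a₁ ≤ a₀ →
        (143 * ((((3 + 4 : ℕ) : ℝ)) ^ 2 / 4) ^ 2) * (2 * (B * a₁)) ≤ 1 / 3 →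
        2 * (2 * (B * a₁)) ≤ 2 * deltaSU (Fin 2) / (((3 + 4) * L : ℕ) : ℝ) ^ 2 →
        Thm1GlobalMinAt L a₀ a₁ B →
        ∃ (b₁ p₁ : ℝ), ∀ (b₀ p₀ : ℝ), b₁ ≤ b₀ → p₁ ≤ p₀ →
          ∃ 𝔠 : AlphaConsts L (suGroupModel 2).N, 𝔠.b₀ = b₀ ∧ 𝔠.p₀ = p₀ ∧ 𝔠.B₃ = B ∧
            4 * 𝔠.B₃ * (L : ℝ) ^ 2 * avgWindowFactor L ≤ 𝔠.C68 ∧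
            Real.exp (𝔠.p₀ - 1) ≤ 3 * C0 3 * 𝔠.C68 * (𝔠.b₀ * Q0 𝔠.p₀) ∧
            (𝔠.b₀ * Q0 𝔠.p₀) * (2 * (L : ℝ) ^ 2 * avgWindowFactor L) ^ 2 ≤ 3 * C0 3 * 𝔠.C68 * a₁ ^ 2 ∧
            ∀ (F : T3Family) (hF : F.L = L),
              (∀ (γ : ℝ) (hγ : 0 < γ) (hγ1 : γ ≤ (min (hF ▸ 𝔠).gamma0 1) ^ 2) (K : ℕ),
                AlphaInputsT3AC.SmallFactor71OfRecT3 F (hF ▸ 𝔠) γ hγ hγ1 K) ∧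
              ∀ (γ : ℝ) (hγ : 0 < γ) (hγ1 : γ ≤ (min (hF ▸ 𝔠).gamma0 1) ^ 2) (K : ℕ),
                (∃ Ut : (k : ℕ) → GaugeField (F.P K) k (Matrix.specialUnitaryGroup (Fin 2) ℂ) →
                    GaugeField (F.P K) 0 (Matrix.specialUnitaryGroup (Fin 2) ℂ),
                  AlphaInputsT3AC.TrivMinimiserRowsT3 F (hF ▸ 𝔠) γ hγ hγ1 a₀ a₁ K Ut) →
                ∃ Ut : (k : ℕ) → GaugeField (F.P K) k (Matrix.specialUnitaryGroup (Fin 2) ℂ) →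
                    GaugeField (F.P K) 0 (Matrix.specialUnitaryGroup (Fin 2) ℂ),
                  AlphaInputsT3AC.TrivMinimiserRowsT3 F (hF ▸ 𝔠) γ hγ hγ1 a₀ a₁ K Ut ∧
                    AlphaInputsT3AC.DataRowsT3XsChiSel F (hF ▸ 𝔠) γ hγ hγ1 K Ut) :
    Summit.QuantumFields.YangMills.Theses.UnitScaleTilt.HistoryTailL :=
  historyTailL_of_thm1In8_selXsV4DataRows_allL (thm1In8_allL_of_existenceMinimalOrbit hEX) hrows

/-! ## §3 The same through the nested-display closer (seam discharged from the `γ₀`-row; recorded, not the display of record) -/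

/-- ★★ **THE v4 χ-RECORD TEXT `∀ L, Odd L → 1 < L → AlphaInputsT3ACv4RecChi L` (19936's one displayed row, ★★OWNER WORD 84) FROM EX AND NODE O's NESTED v4 SUPPLIER ROWS** —
★w6-19936 g2's ✓ `HistoryTailSelSupplier.laneRecordsV4Chi_of_thm1In8_nestedDataRows_dL` (the seam (71)_sym discharged from the record's numeral-free `γ₀`-tolerance row, every odd
`L > 1`) with `hT8` discharged by §1; `hrows` VERBATIM that closer's second binder. [cite: Balaban1985Variational, Thm 1 (8) p.279, Prop. 7 p.299, Prop. 8 p.304; Balaban1985UV3, (7) p.257, (47) p.267, (67)–(71) p.273 and Thm 2 p.272] -/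
theorem laneRecordsV4Chi_of_existenceMinimalOrbit_nestedDataRows_dL
    (hEX : ∀ (L : ℕ), 1 < L → ∀ (B₃ : ℝ), 4 < B₃ → ∃ a₁' O₁ : ℝ, 0 < a₁' ∧ 1 ≤ O₁ ∧
      ∀ (F : T3Family), F.L = L → ∀ (n K : ℕ) (hnK : n < K) (ε₁ : ℝ), 0 < ε₁ →
        ∀ V : GaugeField (F.P n) 0 (Matrix.specialUnitaryGroup (Fin 2) ℂ), PlaqSmall ε₁ V →
          ∀ U₀ : GaugeField (F.P K) 0 (Matrix.specialUnitaryGroup (Fin 2) ℂ), RegPr F n K ((L : ℝ) ^ 3 * B₃ * ε₁) U₀ → U₀ ∈ fibre F ℰp n K hnK.le V →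
            ε₁ ≤ a₁' → ∃ U ∈ regFibrePr F n K hnK.le (O₁ * (L : ℝ) ^ 3 * B₃ * ε₁) V,
              IsMinOn (fun W : GaugeField (F.P K) 0 (Matrix.specialUnitaryGroup (Fin 2) ℂ) => wilsonAction4 W)
                (regFibrePr F n K hnK.le (O₁ * (L : ℝ) ^ 3 * B₃ * ε₁) V) U)
    (hrows : ∀ L : ℕ, Odd L → 1 < L → ∃ (B₀ A₀ A₁ : ℝ), 0 < A₀ ∧ 0 < A₁ ∧
      ∀ (B a₀ a₁ : ℝ), B₀ ≤ B → 1 ≤ 2 * B → 0 < a₀ → a₀ ≤ A₀ → 0 < a₁ → a₁ ≤ A₁ → B * a₁ ≤ a₀ →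
        (143 * ((((3 + 4 : ℕ) : ℝ)) ^ 2 / 4) ^ 2) * (2 * (B * a₁)) ≤ 1 / 3 →
        2 * (2 * (B * a₁)) ≤ 2 * deltaSU (Fin 2) / (((3 + 4) * L : ℕ) : ℝ) ^ 2 →
        Thm1GlobalMinAt L a₀ a₁ B →
        ∃ (b₁ p₁ : ℝ), ∀ (b₀ p₀ : ℝ), b₁ ≤ b₀ → p₁ ≤ p₀ → ∀ (φ : ℝ → ℝ), (∀ x : ℝ, 0 < x → 0 < φ x) →
          ∃ 𝔠 : AlphaConsts L (suGroupModel 2).N, 𝔠.b₀ = b₀ ∧ 𝔠.p₀ = p₀ ∧ 𝔠.B₃ = B ∧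
            4 * 𝔠.B₃ * (L : ℝ) ^ 2 * avgWindowFactor L ≤ 𝔠.C68 ∧
            Real.exp (𝔠.p₀ - 1) ≤ 3 * C0 3 * 𝔠.C68 * (𝔠.b₀ * Q0 𝔠.p₀) ∧
            (𝔠.b₀ * Q0 𝔠.p₀) * (2 * (L : ℝ) ^ 2 * avgWindowFactor L) ^ 2 ≤ 3 * C0 3 * 𝔠.C68 * a₁ ^ 2 ∧
            7 * L + 3 ≤ 𝔠.M₁ ∧
            𝔠.gamma0 ≤ ((φ 𝔠.C68 / (𝔠.b₀ * Q0 𝔠.p₀)) ^ 2) ^ 2 ∧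
            ∀ (F : T3Family) (hF : F.L = L) (γ : ℝ) (hγ : 0 < γ) (hγ1 : γ ≤ (min (hF ▸ 𝔠).gamma0 1) ^ 2) (K : ℕ),
              (∃ Ut : (k : ℕ) → GaugeField (F.P K) k (Matrix.specialUnitaryGroup (Fin 2) ℂ) →
                  GaugeField (F.P K) 0 (Matrix.specialUnitaryGroup (Fin 2) ℂ),
                AlphaInputsT3AC.TrivMinimiserRowsT3 F (hF ▸ 𝔠) γ hγ hγ1 a₀ a₁ K Ut) →
              ∃ Ut : (k : ℕ) → GaugeField (F.P K) k (Matrix.specialUnitaryGroup (Fin 2) ℂ) →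
                  GaugeField (F.P K) 0 (Matrix.specialUnitaryGroup (Fin 2) ℂ),
                AlphaInputsT3AC.TrivMinimiserRowsT3 F (hF ▸ 𝔠) γ hγ hγ1 a₀ a₁ K Ut ∧
                  AlphaInputsT3AC.DataRowsT3NestedChiSel F (hF ▸ 𝔠) γ hγ hγ1 K Ut) :
    ∀ L : ℕ, Odd L → 1 < L → AlphaInputsT3ACv4RecChi L :=
  laneRecordsV4Chi_of_thm1In8_nestedDataRows_dL (thm1In8_allL_of_existenceMinimalOrbit hEX) hrows

/-- ★★ **`HistoryTailL` FROM EX AND NODE O's NESTED v4 SUPPLIER ROWS** — §3 through 19936's one displayed row's concluder ✓ `HistoryTailLaneTailV4Chi.historyTailL_of_laneRecordsV4Chi`.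
CONDITIONAL — EX and the nested (O⁗χ) rows are displayed, not proved. [cite: Balaban1985Variational, Thm 1 (8) p.279, Prop. 7 p.299, Prop. 8 p.304; Balaban1985UV3, (5) p.256, (47) p.267, (71) p.273 and Thm 2 p.272] -/
theorem historyTailL_of_existenceMinimalOrbit_nestedDataRows_dL
    (hEX : ∀ (L : ℕ), 1 < L → ∀ (B₃ : ℝ), 4 < B₃ → ∃ a₁' O₁ : ℝ, 0 < a₁' ∧ 1 ≤ O₁ ∧
      ∀ (F : T3Family), F.L = L → ∀ (n K : ℕ) (hnK : n < K) (ε₁ : ℝ), 0 < ε₁ →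
        ∀ V : GaugeField (F.P n) 0 (Matrix.specialUnitaryGroup (Fin 2) ℂ), PlaqSmall ε₁ V →
          ∀ U₀ : GaugeField (F.P K) 0 (Matrix.specialUnitaryGroup (Fin 2) ℂ), RegPr F n K ((L : ℝ) ^ 3 * B₃ * ε₁) U₀ → U₀ ∈ fibre F ℰp n K hnK.le V →
            ε₁ ≤ a₁' → ∃ U ∈ regFibrePr F n K hnK.le (O₁ * (L : ℝ) ^ 3 * B₃ * ε₁) V,
              IsMinOn (fun W : GaugeField (F.P K) 0 (Matrix.specialUnitaryGroup (Fin 2) ℂ) => wilsonAction4 W)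
                (regFibrePr F n K hnK.le (O₁ * (L : ℝ) ^ 3 * B₃ * ε₁) V) U)
    (hrows : ∀ L : ℕ, Odd L → 1 < L → ∃ (B₀ A₀ A₁ : ℝ), 0 < A₀ ∧ 0 < A₁ ∧
      ∀ (B a₀ a₁ : ℝ), B₀ ≤ B → 1 ≤ 2 * B → 0 < a₀ → a₀ ≤ A₀ → 0 < a₁ → a₁ ≤ A₁ → B * a₁ ≤ a₀ →
        (143 * ((((3 + 4 : ℕ) : ℝ)) ^ 2 / 4) ^ 2) * (2 * (B * a₁)) ≤ 1 / 3 →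
        2 * (2 * (B * a₁)) ≤ 2 * deltaSU (Fin 2) / (((3 + 4) * L : ℕ) : ℝ) ^ 2 →
        Thm1GlobalMinAt L a₀ a₁ B →
        ∃ (b₁ p₁ : ℝ), ∀ (b₀ p₀ : ℝ), b₁ ≤ b₀ → p₁ ≤ p₀ → ∀ (φ : ℝ → ℝ), (∀ x : ℝ, 0 < x → 0 < φ x) →
          ∃ 𝔠 : AlphaConsts L (suGroupModel 2).N, 𝔠.b₀ = b₀ ∧ 𝔠.p₀ = p₀ ∧ 𝔠.B₃ = B ∧
            4 * 𝔠.B₃ * (L : ℝ) ^ 2 * avgWindowFactor L ≤ 𝔠.C68 ∧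
            Real.exp (𝔠.p₀ - 1) ≤ 3 * C0 3 * 𝔠.C68 * (𝔠.b₀ * Q0 𝔠.p₀) ∧
            (𝔠.b₀ * Q0 𝔠.p₀) * (2 * (L : ℝ) ^ 2 * avgWindowFactor L) ^ 2 ≤ 3 * C0 3 * 𝔠.C68 * a₁ ^ 2 ∧
            7 * L + 3 ≤ 𝔠.M₁ ∧
            𝔠.gamma0 ≤ ((φ 𝔠.C68 / (𝔠.b₀ * Q0 𝔠.p₀)) ^ 2) ^ 2 ∧
            ∀ (F : T3Family) (hF : F.L = L) (γ : ℝ) (hγ : 0 < γ) (hγ1 : γ ≤ (min (hF ▸ 𝔠).gamma0 1) ^ 2) (K : ℕ),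
              (∃ Ut : (k : ℕ) → GaugeField (F.P K) k (Matrix.specialUnitaryGroup (Fin 2) ℂ) →
                  GaugeField (F.P K) 0 (Matrix.specialUnitaryGroup (Fin 2) ℂ),
                AlphaInputsT3AC.TrivMinimiserRowsT3 F (hF ▸ 𝔠) γ hγ hγ1 a₀ a₁ K Ut) →
              ∃ Ut : (k : ℕ) → GaugeField (F.P K) k (Matrix.specialUnitaryGroup (Fin 2) ℂ) →
                  GaugeField (F.P K) 0 (Matrix.specialUnitaryGroup (Fin 2) ℂ),
                AlphaInputsT3AC.TrivMinimiserRowsT3 F (hF ▸ 𝔠) γ hγ hγ1 a₀ a₁ K Ut ∧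
                  AlphaInputsT3AC.DataRowsT3NestedChiSel F (hF ▸ 𝔠) γ hγ hγ1 K Ut) :
    Summit.QuantumFields.YangMills.Theses.UnitScaleTilt.HistoryTailL :=
  historyTailL_of_laneRecordsV4Chi (laneRecordsV4Chi_of_existenceMinimalOrbit_nestedDataRows_dL hEX hrows)

end Summit.QuantumFields.YangMills.Theorems.HistoryTailOfExistenceMinimalOrbit

end
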